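import Mathlib

/-!
# R19 — fan calculus for fibre-pair towers: the kernel-checkable core of R19-1 (N3 is a Galois artefact, not a tower)

res-L1-w45b-idea-1 g28 · card `Ideas/toric-towers.md` ROUND 19 · memo `R19-FAN-CALCULUS.md`.
OURS, counted 0, AI-written (weaker than expert review); nothing here is attributed to Hironaka; nothing of
`EquisingularLiftNatThree` is proved by this file.  Elementary identities only (`ring` / `decide` / Mathlib's
`ZMod.exists_sq_eq_neg_one_iff`).

Content.  `N3 = (x²+y⁴)² + x⁵ + z⁶ + y⁹ + x¹⁰ + y¹⁰ + z¹⁰`.  In the chart of the smooth cone `⟨Π, E₁, E₄⟩ =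
⟨(1,0,0), (2,1,1), (4,2,3)⟩` of the fan reached after `P · (Π,S) · (S,E₁) · (Z,E₁) · (E₁,E₃)` the monomial map is
`x = a·b²·c⁴, y = b·c², z = b·c³` (`a = t_Π, b = t_{E₁}, c = t_{E₄}`), the total transform factors as
`b⁶ · c¹⁶ · G` and the strict transform `G` restricted to the exceptional divisor `E₄ = {c = 0}` is
`b² · (a² + 1)²`: the torus curve `{b = 0}` (doubled: the next pair round `(E₁,E₄)`) and the DOUBLED pair of lines
`{a² + 1 = 0}` = `Γ̄₊ ⊔ Γ̄₋`, which splits exactly when `−1` is a square — false in `𝔽_10007`, true in `𝔽_10009` and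
over any algebraically closed field.
-/

set_option linter.dupNamespace false -- mandated namespace `Summit.<Summit>.<Problem>` of this single-conjunct summit

namespace Summit.ResolutionOfSingularities.ResolutionOfSingularities.Cruxes.EquisingularLiftNatThree.ToricTowers.R19

open MvPolynomial

section chart
variable {R : Type*} [CommRing R]

/-- the germ N3 as a polynomial function of three ring elements -/
def N3 (x y z : R) : R := (x^2 + y^4)^2 + x^5 + z^6 + y^9 + x^10 + y^10 + z^10

/-- the strict transform of N3 in the chart `⟨Π, E₁, E₄⟩` (coordinates `a, b, c`; `E₄ = {c = 0}`, `E₁ = {b = 0}`, `St Π = {a = 0}`) -/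
def G (a b c : R) : R :=
  b^2 * (a^2 + 1)^2 + c^2 * (1 + b^3) + a^5 * b^4 * c^4 + b^4 * c^4 + b^4 * c^14 + a^10 * b^14 * c^24

/-- TOTAL TRANSFORM FACTORISATION in the chart `x = a b² c⁴, y = b c², z = b c³`: `N3 = b⁶ c¹⁶ · G`
(`6 = d_{E₁} = ⟨(2,1,1),(0,0,6)⟩`, `16 = d_{E₄} = ⟨(4,2,3),(4,0,0)⟩`). -/
theorem N3_chart (a b c : R) : N3 (a * b^2 * c^4) (b * c^2) (b * c^3) = b^6 * c^16 * G a b c := by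
  unfold N3 G; ring

/-- On the exceptional divisor `E₄ = {c = 0}` the strict transform is `b² (a² + 1)²`: a doubled torus curve and a
doubled conic pair. -/
theorem G_on_E4 (a b : R) : G a b 0 = b^2 * (a^2 + 1)^2 := by
  unfold G; ring

/-- Where `−1` has a square root `i`, the pair of lines splits: `a² + 1 = (a − i)(a + i)`. -/
theorem conic_pair_splits (i a : R) (hi : i * i = -1) : a^2 + 1 = (a - i) * (a + i) := by
  have : (a - i) * (a + i) = a^2 - i * i := by ring
  rw [this, hi]; ring

/-- the strict transform of N3 one pair round later, in the chart of the smooth cone `⟨Π, E₄, E₅⟩ = ⟨(1,0,0),(4,2,3),(6,3,4)⟩`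
(`x = a c⁴ e⁶, y = c² e³, z = c³ e⁴`; `E₄ = {c = 0}`, `E₅ = {e = 0}`; `e` is the coordinate ALONG `Γ̄ ⊂ E₄`). -/
def G₂ (a c e : R) : R :=
  (a^2 + 1)^2 + c^2 * (1 + e^3) + a^5 * c^4 * e^6 + c^4 * e^6 + c^14 * e^16 + a^10 * c^24 * e^36

/-- TOTAL TRANSFORM in the chart `⟨Π, E₄, E₅⟩`: `N3 = c¹⁶ e²⁴ · G₂` (`24 = d_{E₅} = ⟨(6,3,4),(4,0,0)⟩`).  On `E₄ = {c = 0}`: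
`G₂ = (a² + 1)²` — the doubled conic pair ALONE (the torus curve of the previous chart has been blown up), with transversal
datum `c² · (1 + e³)`: a unit at the crossing `e = 0` with `E₅` (the memo's «uniform, `D₂(0) ≠ 0`») and simple zeros at
`e³ = −1` (the «pinch points»). -/
theorem N3_chart₂ (a c e : R) : N3 (a * c^4 * e^6) (c^2 * e^3) (c^3 * e^4) = c^16 * e^24 * G₂ a c e := by
  unfold N3 G₂; ring

theorem G₂_on_E4 (a e : R) : G₂ a 0 e = (a^2 + 1)^2 := by
  unfold G₂; ring

/-- the strict transform after blowing up the line `Γ̄₊ = {a = i, c = 0}` (chart `a = i + a₁ c`), where `i² = −1` -/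
def G₃ (i a₁ c e : R) : R :=
  a₁^2 * (2 * i + a₁ * c)^2 + (1 + e^3) + (i + a₁ * c)^5 * c^2 * e^6 + c^2 * e^6 + c^12 * e^16
    + (i + a₁ * c)^10 * c^22 * e^36

/-- ONE Γ-ROUND: substituting `a = i + a₁ c` (the `c`-chart of the blow-up of `Γ̄₊`) the strict transform `G₂` acquires
exactly the factor `c²` — order 2 along `Γ̄₊`, i.e. `Γ̄₊ ⊂ Sing(St N3)` with multiplicity 2 — and the new strict
transform is `G₃`. -/
theorem G₂_blowup_line (i a₁ c e : R) (hi : i * i = -1) :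
    G₂ (i + a₁ * c) c e = c^2 * G₃ i a₁ c e := by
  unfold G₂ G₃
  linear_combination ((i * i + 1) + 2 * c * a₁ * (2 * i + a₁ * c)) * hi

/-- … and on the new exceptional divisor `{c = 0}` it is `1 + e³ − 4 a₁²`. -/
theorem G₃_on_exc (i a₁ e : R) (hi : i * i = -1) : G₃ i a₁ 0 e = 1 + e^3 - 4 * a₁^2 := by
  unfold G₃
  linear_combination (4 * a₁^2) * hi

/-- SMOOTH AFTER ONE ROUND (Jacobian criterion along the new exceptional divisor, characteristic `≠ 2, 3`):
`1 + e³ − 4a₁²` and its two partial derivatives `−8a₁`, `3e²` have no common zero.  (The partials of `G₃` in `a₁, e`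
at `c = 0` are those of `G₃|_{c=0}`.)  Hence no second round and no leaf: the tower over `Γ̄_{(4,2,3)}` has height
`⌊ν/2⌋ = 1`, pinch points included. -/
theorem G₃_exc_smooth {k : Type*} [Field k] (h2 : (8 : k) ≠ 0) (h3 : (3 : k) ≠ 0) (a₁ e : k)
    (hval : 1 + e^3 - 4 * a₁^2 = 0) (hda : -8 * a₁ = 0) (hde : 3 * e^2 = 0) : False := by
  have ha : a₁ = 0 := by
    have : (8 : k) * a₁ = 0 := by linear_combination -hda
    rcases mul_eq_zero.mp this with h | h
    · exact absurd h h2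
    · exact h
  have he : e = 0 := by
    rcases mul_eq_zero.mp hde with h | h
    · exact absurd h h3
    · exact pow_eq_zero_iff (n := 2) (by norm_num) |>.mp h
  subst ha; subst he
  norm_num at hval

end chart

section galois

/-- `10007` is prime. -/
theorem prime_10007 : Nat.Prime 10007 := by norm_num

/-- `10009` is prime. -/
theorem prime_10009 : Nat.Prime 10009 := by norm_num

/-- THE ARTEFACT: `−1` is NOT a square in `𝔽_10007` (`10007 ≡ 3 mod 4`), so `{a² + 1 = 0}` is one non-split
(conjugate) pair there — atlas7's `coordinatize_curve` has no degree-one Gröbner element to use. -/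
theorem neg_one_not_square_10007 : ¬ IsSquare (-1 : ZMod 10007) := by
  haveI : Fact (Nat.Prime 10007) := ⟨prime_10007⟩
  rw [ZMod.exists_sq_eq_neg_one_iff]
  decide

/-- … and it IS a square in `𝔽_10009` (`10009 ≡ 1 mod 4`): there the centre is two rational lines. -/
theorem neg_one_square_10009 : IsSquare (-1 : ZMod 10009) := by
  haveI : Fact (Nat.Prime 10009) := ⟨prime_10009⟩
  rw [ZMod.exists_sq_eq_neg_one_iff]
  decide

/-- Over an algebraically closed field (the setting of `EquisingularLiftNatThree`: `[IsAlgClosed k]`) `−1` is a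
square, so the centre `Γ̄₊ ⊔ Γ̄₋` is always two lines. -/
theorem neg_one_square_of_isAlgClosed (k : Type*) [Field k] [IsAlgClosed k] : IsSquare (-1 : k) := by
  obtain ⟨i, hi⟩ := IsAlgClosed.exists_pow_nat_eq (-1 : k) (n := 2) (by norm_num)
  exact ⟨i, by rw [← hi]; ring⟩

end galois

end Summit.ResolutionOfSingularities.ResolutionOfSingularities.Cruxes.EquisingularLiftNatThree.ToricTowers.R19
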